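import Mathlib
import HarnessLib
import HarnessLib.Audit
import Summits.AtomisticToContinuum.Statement
import Literature.MathematicalPhysics.KineticTheory.NewtonianFlow

/-!
Route: AffineAnchor

CLOSED (retired) 2026-08-15T13:38:26Z by operator:999:1257524 — reason: not-a-thesis: assembly does not conclude the sub-problem Statement — note: D-0027 §2.1 audit (human 2026-08-15: routes that do not decide the summit are removed): the assembly concludes `Literature.MathematicalPhysics.KineticTheory.HeatConduction.FouriersLaw`, not the sub-problem statement; a NEW conforming route may be opened from the same idea (generated `closes : … → _r. The file is kept as the record of this route; refuted decls are indexed as negative knowledge (`ledger negatives`).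

# Route AffineAnchor — affine-group symmetry of the scale-free anchor gives its spectral type for
free; Fourier at the anchor = ring Drude decay + regular DC limit

X_AA (AFFINE ANCHOR LINE; realises idea card affine-group-anchor-spectral-type). Work on the
conjunct's scale-free anchor, the CLOSED
homogeneous quartic chain H = Σ p²/2 + μ Σ q⁴/4 + Σ_bonds r⁴/4 (μ > 0; free ends, or the RING with
the wrap bond), at Gibbs temperature T,
with current autocorrelation C_N(t) = E_T[J_N(Φ_t ·) J_N]. It suffices to show: (K1,
AnchorSpectralType — theorem-grade, do first) the
dilations (q,p) ↦ (aq,a²p) conjugate the flow to its time-rescalings, so every spectral measure is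
an atom at 0 plus an ABSOLUTELY
CONTINUOUS part and C_N(t) → D_N := ‖E_T[J_N|ℐ]‖² at every N (relative mixing, no chaos input); then
Fourier's law at the anchor splits
into exactly two statements about rings — (C1, RingDrudeDecay) the Drude atom per site vanishes,
D_N/N → 0, and (C2, AnchorRegularConductivity)
the regular part has a thermodynamic-then-DC limit k(μ,T) > 0 — which (K3, AnchorKuboFourier: ring
Green–Kubo ⇒ BLR response, κ₀ = k/T²)
give FouriersLawFor for the open anchor chain quarticChain μ γ, and (K4, AnchorToConjunct — import
slot = thesis of card
scale-free-quartic-anchor: exact conjugacy + continuation in η = (βT)^{-1/2} + low-T gluing) the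
conjunct.
Lean: `AnchorSpectralType ∧ RingDrudeDecay ∧ AnchorRegularConductivity ∧ AnchorKuboFourier ∧
AnchorToConjunct`

## Assembly
Honest glue, ~150 Lean lines of choice + real analysis (smoke-tested rc 0 in the planner folder,
GlueTest.lean: K1 instantiates on the ring
family at θ = 1 with f := J_N; AnchorFiniteResponse + AnchorKuboFourier give the ∃D-clause;
AnchorToConjunct ∘ AnchorNess ∘ clause (ii) closes FouriersLaw). Fix μ, γ > 0; by AnchorToConjunct
it
suffices to prove FouriersLawFor (quarticChain μ γ). Clause (i) is AnchorNess. Clause (ii): for T >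
0 take the ring flow family Φ from
AnchorFlow (choice over N); AnchorSpectralType with f := J_N (in L² by AnchorCurrentMemLp) gives
σ_N, the cos-representation (hence C_N
continuous and |C_N| ≤ C_N(0)) and C_N(t) → D_N := σ_N{0}; RingDrudeDecay gives D_N/N → 0;
AnchorRegularConductivity gives k(T) > 0 and
K; DrudeRegularGlue upgrades to the full Abel means N⁻¹∫e^{−εt}C_N → K(ε) → k(T);
AnchorFiniteResponse (uniqueness from AnchorNess) gives the response
limits D_N^{BLR} of any steady-state family (choice) and AnchorKuboFourier their convergence
D_N^{BLR} → k(T)/T²; put κ(T) := k(T)/T² (Classical.choose, κ := 1 for T ≤ 0), positive.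

Rationale: WHY THIS LINE. The anchor's mechanical similarity (LandauLifshitzMechanics1976 §10: H(aq,a²p) = a⁴H,
Φ_t∘S_a = S_a∘Φ_{at}) makes dilations U_a and the
Koopman group V_t a unitary representation of the affine group Aff⁺(ℝ) on L²(Liouville), U_a V_t
U_a⁻¹ = V_{at}; the Gelfand–Fomin /
Mautner–Moore argument for horocycle flows (GelfandFomin1952; Tomter in
book:chern1970-global-analysis Prop. 20 pp. 389–390: P(μ) ↦
P(e^{tλ}μ) ⇒ Weyl relations ⇒ Lebesgue spectrum; KatokThouvenot2006; self-similar flows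
FraczekLemanczyk2009, Ryzhikov2018) then hands over
the spectral TYPE of a non-integrable anharmonic lattice at every N and T with no estimate, and the
unitary f ↦ fρ_T^{1/2} moves it to every
Gibbs state (Bochner is proved in tree: Literature.Analysis.FunctionSpaces.bochner). Imported areas:
unitary representation theory /
homogeneous dynamics (spectral type from symmetry), condensed-matter Drude-weight phenomenology made
exact at finite N (the σ(ω) = D δ + σ_reg
split: HeidrichMeisnerHoneckerCabraBrenig2003, RigolShastry2008, Mazur1969 / in-tree
Mazur.tendsto_inv_mul_integral_inner), and the
Olla-school ring convention for Green–Kubo (BernardinOlla2005, BasileBernardinOlla2009: κ =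
lim_{ε↓0} lim_N of Laplace-transformed ring
correlations). What no open route does: FourierGreenKubo / FeketeResistance / LocalOhmRigidity /
SuperadditiveJunction all work T-pointwise on
pinnedChain with infinite-volume or open-chain objects; none uses the anchor, closed rings, or a
symmetry-given spectral structure, and
none has a crux closable today — here K1 is, and it fixes what finite closed chains can certify
(free ends: GK_N ≡ 0 exactly, support
FreeEndInsulator; rings: one chiral atom + an L¹ density).

RANKED CRUXES. #2 AnchorSpectralType (crux) — (card item 1, AffineAnchor, weak form actually used)
For every N, μ > 0, wrap strength θ ≥ 0 (θ = 0 free ends, θ = 1 ring), T > 0, the Newtonian flow Φ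
of H_θ = Σp²/2 + μΣq⁴/4 + Σ_{i<N-1}(q_{i+1}−q_i)⁴/4 + θ(q_0−q_{N−1})⁴/4 and every f ∈ L²(Gibbs_T):
there is a finite measure σ_f on ℝ with E_T[f(Φ_t·)f] = ∫cos(ωt)dσ_f(ω) for all t, σ_f restricted to
ℝ∖{0} absolutely continuous (no eigenvalues off 0, no singular continuous part), and E_T[f(Φ_t·)f] →
σ_f{0} = ‖E_T[f|ℐ]‖² as t → ∞ (relative mixing). Proof sketch: U_a f = a^{3N/2} f∘S_a and V_t are
unitary on L²(Leb) (Liouville) with U_a V_t U_a⁻¹ = V_{at}; averaging σ_{U_a f} (= dilates of σ_f)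
over a gives an a.c. measure dominating σ_f off 0 (Mackey–Weil on (ℝ_{>0},·)); transfer to L²(Gibbs)
by f ↦ fρ_T^{1/2}; Riemann–Lebesgue. [difficulty: L] (why it might fail: Mathematically classical
(Bochner in tree, Gelfand–Fomin/Mackey class argument); the risk is as typed: IsFlow must pin the
cubic-force flow globally, Liouville for a non-Lipschitz field needs truncation, and 'σ ≪ Leb off 0'
needs spectral projections Mathlib lacks (smeared-operator substitute).) [GelfandFomin1952,
KatokThouvenot2006, FraczekLemanczyk2009, Ryzhikov2018, book:chern1970-global-analysis,
LandauLifshitzMechanics1976, KozlovTreshchev2003]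
#3 AnchorRegularConductivity (crux) — (card (C2), Abel / thermodynamic-limit-first form) RING (θ =
1), every μ, T > 0, with J_N = Σ_bonds −½(p_i+p_{i+1})(q_{i+1}−q_i)³ (wrap bond included), C_N(t) =
E_T[J_N(Φ_t·)J_N] and D_N = lim_t C_N(t) (supplied by AnchorSpectralType): the REGULAR part has a DC
limit — ∃ k > 0 and K with N⁻¹∫_0^∞ e^{−εt}(C_N(t) − D_N) dt → K(ε) as N → ∞ for every ε > 0, and
K(ε) → k as ε ↓ 0. Then κ₀(T) = k/T² and, by the extra amplitude–time scaling, k(μ,T) = T^{9/4}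
k(μ,1): one number per μ. [deps: AnchorSpectralType] [difficulty: open-problem] (why it might fail:
This is the transport problem at the anchor: no N-uniform control of the a.c. density near ω = 0
exists for any deterministic anharmonic chain; sticky island hierarchies could make K(ε) blow up
(anomalous) or vanish as ε ↓ 0 although every σ_N is a.c.) [BonettoLebowitzReyBellet2000,
LepriLiviPoliti2003, BernardinOlla2005, BasileBernardinOlla2009, CanestrariLiveraniOlla2026,
HeidrichMeisnerHoneckerCabraBrenig2003]
#4 RingDrudeDecay (crux) — (card (C1) ChiralIslandDecay) RING, every μ, T > 0: the finite-N Drude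
atom per site vanishes, D_N/N → 0 (D_N = lim_t C_N(t), supplied by AnchorSpectralType). By momentum
reversal Π (ΠJ = −J, Πℐ = ℐ) the atom D_N = ‖E_T[J_N|ℐ]‖² is carried by Π-asymmetric (circulating,
chiral) invariant components only, so the statement says: chiral regular islands have vanishing
Gibbs weight per site — 'not ballistic at the anchor', the necessary half of 0 < κ₀ < ∞ on closed
chains. [deps: AnchorSpectralType] [difficulty: L] (why it might fail: A positive-measure family of
circulating (Π-asymmetric) KAM islands with non-vanishing Gibbs weight per site gives D_N ≍ N, a
ballistic component; mixed phase space, no hyperbolicity, and the model is parameter-free, so there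
is no 'generic μ' escape.) [Mazur1969, Zotos2002, MackayPercival1985,
HeidrichMeisnerHoneckerCabraBrenig2003, RigolShastry2008, BenentiCasatiMejiaMonasterioPeyrard2016]
#5 AnchorKuboFourier (crux) — (κ = κ_GK at the anchor, ring form) For the OPEN anchor chain
quarticChain μ γ := OscillatorChain.mk (μq⁴/4) (r⁴/4) γ between Langevin baths and T > 0: if for the
ring flow family the full Green–Kubo Abel means converge, N⁻¹∫_0^∞e^{−εt}C_N(t)dt → K(ε) (N → ∞) and
K(ε) → k (ε ↓ 0), then, under weak-NESS uniqueness, for every steady-state family and every sequence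
D_N of BLR response coefficients (D_N(T) = lim_{δ→0} totalCurrent(ν_{N,T+δ/2,T−δ/2})/δ; existence =
support AnchorFiniteResponse, uniqueness of limits makes it canonical) one has D_N → k/T²
(finite-volume Kubo formula for the thermostatted chain + N-uniform decay + o(N) contact layers; the
witness form vetted on stmt-0742). [deps: AnchorRegularConductivity, RingDrudeDecay] [difficulty:
open-problem] (why it might fail: κ = κ_GK is unproved for every Hamiltonian bulk (BLR §7, Dhar
§9e); at the anchor the bath coupling is the one non-scale-free datum (γ_eff = γT^{-1/4}), contact
layers are T-dependent and must be o(N); needs N-uniform decay for the thermostatted chain.)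
[BonettoLebowitzReyBellet2000, Dhar2008, KunduDharNarayan2009, ReyBellet2003, HairerMajda2009,
CuneoEckmannHairerReyBellet2018]
#6 AnchorToConjunct (crux) — IMPORT SLOT (thesis of card scale-free-quartic-anchor, not this route's
mechanism): Fourier's law for the whole anchor family implies the conjunct, (∀ μ γ > 0,
FouriersLawFor (quarticChain μ γ)) → FouriersLaw — via the proved scaling conjugacy (pinnedChain ω₂
lam β γ at T ≅ H_η at T = 1, η = (βT)^{−1/2}, μ = lam/β), continuation in η for T ≥ T₀ and a
kinetic-regime owner for T < T₀; foreseen layer-2 children EtaContinuation / LowTGluing, to be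
shared with that card's route when it opens. [deps: AnchorKuboFourier] [difficulty: open-problem]
(why it might fail: The antecedent controls only the T → ∞ end of the conjunct: η-continuation may
meet non-perturbative low-amplitude weak links, and T < T₀ is the near-harmonic phonon regime (κ ~
(λT)⁻², LowTemperatureWeakAnharmonicity) where nothing is proved.) [AokiLukkarinenSpohn2006,
CuneoEckmannHairerReyBellet2018, BonettoLebowitzReyBellet2000, LepriLiviPoliti2003]
#9 AnchorCurrentMemLp (support) — For every N, μ > 0, θ ≥ 0, T > 0 the tilted measure
volume.tilted(−H_θ/T) is a probability measure (e^{−H_θ/T} integrable: H_θ ≥ Σp²/2 + μΣq⁴/4) and the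
θ-ring current is in L²(Gibbs) (polynomial × Gaussian-in-p × e^{−quartic}). De-vacuifies
AnchorSpectralType for f = J_N; used by the Assembly. [difficulty: provable-now]
[BonettoLebowitzReyBellet2000, CuneoEckmannHairerReyBellet2018]
#9 AnchorFlow (support) — For every N, μ > 0, θ ≥ 0 the Newtonian flow of H_θ exists globally
(energy conservation + coercivity; local Lipschitz uniqueness), conserves H_θ, and preserves
Lebesgue measure (Liouville — truncate the cubic field on a sublevel set of H_θ and use the tree's
bounded-Lipschitz Liouville, NewtonianFlowLiouville). De-vacuifies the ∀Φ-items; the Assembly needs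
a flow family. [difficulty: provable-now] [BonettoLebowitzReyBellet2000, LanfordLebowitzLieb1977]
#9 DrudeRegularGlue (support) — Pure real analysis: for continuous c_N with |c_N(t)| ≤ c_N(0),
c_N(t) → D_N, D_N/N → 0 and N⁻¹∫_0^∞e^{−εt}(c_N − D_N) → K(ε) for every ε > 0, also
N⁻¹∫_0^∞e^{−εt}c_N → K(ε) (the atom contributes D_N/(Nε) → 0). [difficulty: provable-now]
[BenentiCasatiMejiaMonasterioPeyrard2016]
#9 AnchorFiniteResponse (support) — Finite-N linear response exists for the open anchor chain: for
quarticChain μ γ (μ, γ > 0), under weak-NESS uniqueness, for every steady-state family, T > 0 and N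
the limit D_N = lim_{δ→0, δ≠0} totalCurrent(ν_{N,T+δ/2,T−δ/2})/δ exists (differentiability at
equilibrium of NESS expectations of the polynomial currents in the bath temperatures; ReyBellet2003
Rem 4.4 finite-volume Green–Kubo, HairerMajda2009 framework; the quarticChain analogue of
stmt-0717). [difficulty: L] [ReyBellet2003, HairerMajda2009, CuneoEckmannHairerReyBellet2018,
Carmona2007]
#9 AnchorNess (support) — Clause (i) for the anchor: for quarticChain μ γ (μ, γ > 0), every N and
T_L, T_R > 0, a weak steady state (IsSteadyState) exists and is unique. CEHR2018 Thm 2.13 pattern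
(coupling degree 4 = pinning degree 4, C5 with equality; homogeneity at infinity ideal for the
Lyapunov function) but C1 (non-degenerate interaction) fails at zero stretch, V″(0) = 0 — Hörmander
via V⁗ = 6 ≠ 0; plus the weak-Fokker–Planck identification shared with stmt-0741. [difficulty: L]
[CuneoEckmannHairerReyBellet2018, Carmona2007, EckmannPilletReyBellet1999b, ReyBelletThomas2002]
#9 FreeEndInsulator (support) — (card corollary (3), calibration; not in the Assembly) FREE ENDS (θ
= 0), every N, μ, T > 0: J_N = 𝓛G_N with the energy dipole G_N = Σ_x x·h_x, so J_N ⊥ ker 𝓛: C_N(t) →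
0 as t → ∞ AND the Abel-regularised finite-N Green–Kubo integral ∫_0^∞e^{−εt}C_N(t)dt → 0 as ε ↓ 0 —
finite free-end anchor chains are exact insulators at ω = 0 (σ_J = ω²σ_G), so κ₀ > 0 is a singular N
→ ∞ limit there and closed-chain certificates must live on rings or on the pre-recurrence window.
[difficulty: M] [RigolShastry2008, Mazur1969]

TWO-LAYER PLAN. Foreseen glued splits (k ≤ 3, depth 1), filed only when a prover engages:
AnchorSpectralType ⇐ AffineKoopmanRep (flow + Liouville +
dilation covariance: a strongly continuous unitary representation of Aff⁺(ℝ) on L²(Leb) intertwined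
with L²(Gibbs)) → DilationClassLemma
(abstract: a unitary group conjugate to all its time-dilates has spectral measures a.c. off 0;
Bochner + averaging over dilations +
Riemann–Lebesgue) → AnchorSpectralType. RingDrudeDecay ⇐ ChiralSupport (D_N = Σ over pairs (A, ΠA)
of Π-asymmetric invariant sets of
2μ_T(A)(E[J_N 1_A]/μ_T(A))²) → IslandWeightDecay (Gibbs weight per site of circulating regular
components → 0; converse KAM at T = 1).
AnchorRegularConductivity ⇐ RingLimit (N → ∞ at fixed ε: ring locality, card ring-green-kubo-bypass
(RL) run at the anchor) → DCLimit
(ε ↓ 0). AnchorKuboFourier ⇐ FiniteVolumeKubo (Rey-Bellet Rem 4.4 for quarticChain) → ContactLayer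
(o(N)). AnchorToConjunct ⇐
EtaContinuation → LowTGluing (owned by card scale-free-quartic-anchor; share decls if that card is
routed).

KILL CRITERIA. RingDrudeDecay refuted (an extensive-weight family of circulating islands: D_N ≥ cN
at some μ, T — MD plateau of C_N(t)/N not decaying in
N, then a converse-KAM / interval certificate) ⇒ ballistic component at the anchor: close
`refuted:RingDrudeDecay` and file
¬FouriersLawFor(quarticChain μ γ) as a statement (it would also impugn the conjunct's T → ∞ end via
the scaling conjugacy).
AnchorRegularConductivity refuted with K(ε) → ∞ (anomalous anchor) or → 0 ⇒ close
`refuted:AnchorRegularConductivity`. AnchorSpectralType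
cannot fail mathematically; a typed-form defect (vacuity, junk values) ⇒ restate 1:1, not close.
AnchorKuboFourier refuted (κ ≠ κ_GK at
the anchor) ⇒ pivot: keep K1/C1/C2 as the closed-chain half and re-target the open chain through
FourierGreenKubo's 0742 engine.
FouriersLaw proved elsewhere moots AnchorToConjunct; a route for card scale-free-quartic-anchor
supersedes AnchorToConjunct by sharing.

NOT DECOMPOSED YET. The engine for AnchorRegularConductivity (none claimed: the GK cards' engines —
hypocoercive resolvent, Kadanoff–Martin corner continuity,
Herglotz bracket — run at T = 1 on a parameter-free instance); converse-KAM certification and the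
island census behind RingDrudeDecay
(kit work); the V″(0) = 0 variant of CEHR inside AnchorNess; the children EtaContinuation /
LowTGluing of AnchorToConjunct (card
scale-free-quartic-anchor); the scaling-covariance helper C_{N,T}(t) = T^{5/2} C_{N,1}(T^{1/4}t),
k(μ,T) = T^{9/4}k(μ,1) (rides with
`--supports`); cross-correlation (polarised) and L²(Leb) versions of K1; the free-end singular limit
ω²σ_G′(ω)/N at |ω| ≍ N⁻².

CHEAPEST FALSIFIER. Canonical MD of the anchor RING, μ = 1, T = 1 (all T are conjugate), N = 8, 16,
32, 64, t ≤ 10⁴: C_N(t)/N must settle to a constant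
D_N/N without persistent oscillation (else the hypotheses of AnchorSpectralType are mis-implemented
— it is a theorem), and D_N/N must
fall with N (RingDrudeDecay; expected fast); with free ends C_N(t) → 0 and the running GK integral
must return to 0 after the recurrence
time ≍ N (FreeEndInsulator, an exact identity — a code check). A per-site plateau that does not
decay in N kills RingDrudeDecay and every
closed-chain reading of Fourier at the anchor. Not run in this one-shot plancard session (≈ 1
CPU-hour kit job; recommended as the
refuter's first move).

NUMBERS. Exact scalings (mechanical similarity, AokiLukkarinenSpohn2006 §2 and the card): H(aq, a²p)
= a⁴H, Φ_t∘S_a = S_a∘Φ_{at}, Gibbs_T =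
(S_{T^{1/4}})_* Gibbs_1, J∘S_a = a⁵J, C_{N,T}(t) = T^{5/2}C_{N,1}(T^{1/4}t), k(μ,T) = T^{9/4}k(μ,1),
κ₀(T) = κ₀(1)T^{1/4}; Jacobian of
S_a = a^{3N} (U_a f = a^{3N/2}f∘S_a unitary). De Roeck–Huveneers degrees a = b = 4 (marginal,
outside asymptotic localisation). Free
ends: D_N ≡ 0 and GK_N^{Abel} = 0 exactly for every N (RigolShastry2008 mechanism). Items at open:
12 (5 crux, 6 support, 1 assembly).

DEFINITION REQUESTS. To be filed right after open (shared with cards scale-free-quartic-anchor and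
ring-green-kubo-bypass; every signature above inlines them
and can be restated 1:1 once they land): `quarticChain μ γ : OscillatorChain` (U = μq⁴/4, V = r⁴/4);
`ringHamiltonian` / `ringCurrent`
(free-end OscillatorChain.hamiltonian / Σ bondCurrent plus the wrap bond (N−1, 0) for N ≥ 3);
`currentAutocorrelation P N T Φ t`
(E_Gibbs[J(Φ_t·)J]). No cite facts wanted: Bochner is proved in tree; the dilation-class lemma is to
be PROVED (child DilationClassLemma).

Novelty: Searches (2026-08-15): `lit frontier AtomisticToContinuum --since 2020` (30 rows; none on
self-similarity / Koopman spectra of chains);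
`lit bridges AtomisticToContinuum --cross any` (30 rows; none); `lit search --source crossref` for
"self-similar flows spectral theory
Fraczek Lemanczyk" (hits doi:10.1112/plms/pdp013, doi:10.4213/proc23038), "Drude weight open
boundary conditions Rigol Shastry" (hit
doi:10.1103/physrevb.77.161101, plus Bellomia–Resta 2020 doi:10.1103/physrevb.102.205123), "finite
size Drude weight thermal
conductivity classical anharmonic lattice …" (0 relevant), "Converse KAM MacKay Percival"
(doi:10.1007/bf01209326), "Kozlov Treshchev
weak convergence Liouville" (doi:10.1023/a:1022697321418); `lit search --hybrid "Lebesgue spectrum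
flow conjugate to its time rescalings
horocycle affine group representation"` (10 docs; the hit book:chern1970-global-analysis pp. 358,
389–390 read: Tomter's Prop. 20, the
Gelfand–Fomin/Mautner/Moore method); `lit galaxy search … --star all` ×2 (long phrases, 0 rows;
service saturated once); all 103
FouriersLaw cards via `ledger idea list` and the four route files (no route or card states a
spectral-type theorem for an anharmonic member
or splits finite-N GK into atom + a.c.).
Nearest prior art found: GelfandFomin1952 / book:chern1970-global-analysis Prop. 20 /
KatokThouvenot2006 / FraczekLemanczyk2009 /
Ryzhikov2018 (the lemma: conjugacy to all constant time changes ⇒ Lebesgue spectral type, for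
homogeneous and self-similar fl  [refs: 10.1112/plms/pdp013, 10.4213/proc23038, 10.1103/physrevb.77.161101, 10.1103/physrevb.102.205123, 10.1007/bf01209326, 10.1023/a:1022697321418, doi:10.1112/plms/pdp013, doi:10.4213/proc23038, doi:10.1103/physrevb.77.161101, doi:10.1103/physrevb.102.205123, doi:10.1007/bf01209326, doi:10.1023/a, book:chern1970-global-analysis, GelfandFomin1952, KatokThouvenot2006, FraczekLemanczyk2009, Ryzhikov2018, ]

Barriers (technique_class: scaling-symmetry koopman-spectral-type green-kubo anchor): - technique_class: scaling-symmetry koopman-spectral-type green-kubo anchor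
- Literature.Barriers.AtomisticToContinuum.Mazur1969_inequality: faced, not evaded — D_N is exactly
Mazur/Suzuki's Cesàro limit (in-tree Mazur.tendsto_inv_mul_integral_inner), here an honest limit
supported on chiral invariant components; RingDrudeDecay IS the statement that no odd conserved
structure has extensive weight at the anchor, filed as a refutable crux instead of assumed away;
what K1 adds beyond Mazur is that the remainder is absolutely continuous.
- Literature.Barriers.AtomisticToContinuum.MazurBoundBallisticNarrow: evaded by construction — the
line is Drude-weight-AWARE, not blind: K1 splits the finite-N ring Green–Kubo functional into its
atom D_N and an L¹ regular part, the atom's per-site vanishing is filed as the refutable crux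
RingDrudeDecay (FALSE verbatim for a member with an extensive odd charge: periodic harmonic or Toda
rings give D_N ≍ N by the in-tree Mazur/Suzuki equality), and AnchorRegularConductivity speaks of
the regular part only, so no step 'applies verbatim' to a ballistic member; the entry's conjunct (b)
(finite OPEN chains have zero Drude weight, RigolShastry2008) is exactly support FreeEndInsulator
and is why the transport cruxes live on rings with the thermodynamic limit taken before ε ↓ 0.
- Literature.Barriers.AtomisticToContinuum.HarmonicChainBallisticFlux: void inside the anchor family
(no quadratic part, no ballistic corner, all T conjugate); it returns only i

History (route lifecycle, newest last):
- 2026-08-15T13:38:26Z · CLOSED retired — not-a-thesis: assembly does not conclude the sub-problem Statement (operator:999:1257524)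

sub-problem: FouriersLaw · status: closed(retired) · opened planner-plancard-AtomisticToContinuum-Fourier-254988dc-0 2026-08-15T11:35:35Z · rev 0 · ledger route-AtomisticToContinuum-AffineAnchor
GENERATED by the gate from the ledger (D-0016/17). Provers cite these decls: `theorem foo : Summit.AtomisticToContinuum.FouriersLaw.Theses.AffineAnchor.<Decl> := …` in Summits/AtomisticToContinuum/FouriersLaw/Theorems/<Name>.lean.
-/

namespace Summit.AtomisticToContinuum.FouriersLaw.Theses.AffineAnchor

open scoped BigOperators Topology Manifold Classical MeasureTheory ProbabilityTheory Matrix InnerProductSpace ComplexConjugate ContinuousMap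
open Filter Set Function TopologicalSpace MeasureTheory

attribute [summit_statement] _root_.FouriersLaw

/-- item stmt-AtomisticToContinuum-4901 · crux · rank 2 · closed · moot by None · by planner
why it might fail: Mathematically classical (Bochner in tree, Gelfand–Fomin/Mackey class argument); the risk is as typed: IsFlow must pin the cubic-force flow globally, Liouville for a non-Lipschitz field needs truncation, and 'σ ≪ Leb off 0' needs spectral projections Mathlib lacks (smeared-operator substitute).
sources: GelfandFomin1952, KatokThouvenot2006, FraczekLemanczyk2009, Ryzhikov2018, book:chern1970-global-analysis, LandauLifshitzMechanics1976
[crux] (card item 1, AffineAnchor, weak form actually used) For every N, μ > 0, wrap strength θ ≥ 0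
(θ = 0 free ends, θ = 1 ring), T > 0, the Newtonian flow Φ of H_θ = Σp²/2 + μΣq⁴/4 +
Σ_{i<N-1}(q_{i+1}−q_i)⁴/4 + θ(q_0−q_{N−1})⁴/4 and every f ∈ L²(Gibbs_T): there is a finite measure
σ_f on ℝ with E_T[f(Φ_t·)f] = ∫cos(ωt)dσ_f(ω) for all t, σ_f restricted to ℝ∖{0} absolutely
continuous (no eigenvalues off 0, no singular continuous part), and E_T[f(Φ_t·)f] → σ_f{0} =
‖E_T[f|ℐ]‖² as t → ∞ (relative mixing). Proof sketch: U_a f = a^{3N/2} f∘S_a and V_t are unitary on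
L²(Leb) (Liouville) with U_a V_t U_a⁻¹ = V_{at}; averaging σ_{U_a f} (= dilates of σ_f) over a gives
an a.c. measure dominating σ_f off 0 (Mackey–Weil on (ℝ_{>0},·)); transfer to L²(Gibbs) by f ↦
fρ_T^{1/2}; Riemann–Lebesgue. [difficulty: L] -/
@[route_item "route-AtomisticToContinuum-AffineAnchor"]
def AnchorSpectralType : Prop :=
  ∀ (N : ℕ) (μ θ T : ℝ), 0 < μ → 0 ≤ θ → 0 < T → ∀ H : Literature.MathematicalPhysics.KineticTheory.HeatConduction.PhaseSpace N → ℝ, H = (fun x : Literature.MathematicalPhysics.KineticTheory.HeatConduction.PhaseSpace N => (Literature.MathematicalPhysics.KineticTheory.HeatConduction.OscillatorChain.mk (fun q => μ * q ^ 4 / 4) (fun r => r ^ 4 / 4) 0).hamiltonian N x + θ * ∑ i : Fin N, ∑ j : Fin N, if i.val + 1 = N ∧ j.val = 0 ∧ 2 < N then (x.1 j - x.1 i) ^ 4 / 4 else 0) → ∀ Φ : ℝ → Literature.MathematicalPhysics.KineticTheory.HeatConduction.PhaseSpace N → Literature.MathematicalPhysics.KineticTheory.HeatConduction.PhaseSpace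 N, Literature.MathematicalPhysics.KineticTheory.NewtonianFlow.IsFlow (fun (q : Fin N → ℝ) (i : Fin N) => -Literature.MathematicalPhysics.KineticTheory.HeatConduction.partialQ i H (q, fun _ => 0)) Φ → ∀ f : Literature.MathematicalPhysics.KineticTheory.HeatConduction.PhaseSpace N → ℝ, MeasureTheory.MemLp f 2 ((MeasureTheory.volume : MeasureTheory.Measure (Literature.MathematicalPhysics.KineticTheory.HeatConduction.PhaseSpace N)).tilted (fun x => -H x / T)) → ∃ σ : MeasureTheory.Measure ℝ, MeasureTheory.IsFiniteMeasure σ ∧ (∀ t : ℝ, ∫ x, f (Φ t x) * f x ∂((MeasureTheory.volume : MeasureTheory.Measure (Literature.MathematicalPhysics.KineticTheory.HeatConduction.PhaseSpace N)).tilted (fun x => -H x / T)) = ∫ ω, Real.cos (ω * t) ∂σ) ∧ (σ.restrict {0}ᶜ).AbsolutelyContinuous MeasureTheory.volume ∧ Filter.Tendsto (fun t : ℝ => ∫ x, f (Φ t x) * f x ∂((MeasureTheory.volume : MeasureTheory.Measure (Literature.MathematicalPhysics.KineticTheory.HeatConduction.PhaseSpace N)).tilted (fun x => -H x / T))) Filter.atTop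 (nhds (σ {0}).toReal)

/-- item stmt-AtomisticToContinuum-4902 · crux · rank 3 · closed · moot by None · by planner
why it might fail: This is the transport problem at the anchor: no N-uniform control of the a.c. density near ω = 0 exists for any deterministic anharmonic chain; sticky island hierarchies could make K(ε) blow up (anomalous) or vanish as ε ↓ 0 although every σ_N is a.c.
sources: BonettoLebowitzReyBellet2000, LepriLiviPoliti2003, BernardinOlla2005, BasileBernardinOlla2009, CanestrariLiveraniOlla2026, HeidrichMeisnerHoneckerCabraBrenig2003
[crux] (card (C2), Abel / thermodynamic-limit-first form) RING (θ = 1), every μ, T > 0, with J_N =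
Σ_bonds −½(p_i+p_{i+1})(q_{i+1}−q_i)³ (wrap bond included), C_N(t) = E_T[J_N(Φ_t·)J_N] and D_N =
lim_t C_N(t) (supplied by AnchorSpectralType): the REGULAR part has a DC limit — ∃ k > 0 and K with
N⁻¹∫_0^∞ e^{−εt}(C_N(t) − D_N) dt → K(ε) as N → ∞ for every ε > 0, and K(ε) → k as ε ↓ 0. Then κ₀(T)
= k/T² and, by the extra amplitude–time scaling, k(μ,T) = T^{9/4} k(μ,1): one number per μ. [deps:
AnchorSpectralType] [difficulty: open-problem] -/
@[route_item "route-AtomisticToContinuum-AffineAnchor"]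
def AnchorRegularConductivity : Prop :=
  ∀ (μ T : ℝ), 0 < μ → 0 < T → ∀ H : (N : ℕ) → Literature.MathematicalPhysics.KineticTheory.HeatConduction.PhaseSpace N → ℝ, (∀ N : ℕ, H N = fun x : Literature.MathematicalPhysics.KineticTheory.HeatConduction.PhaseSpace N => (Literature.MathematicalPhysics.KineticTheory.HeatConduction.OscillatorChain.mk (fun q => μ * q ^ 4 / 4) (fun r => r ^ 4 / 4) 0).hamiltonian N x + ∑ i : Fin N, ∑ j : Fin N, if i.val + 1 = N ∧ j.val = 0 ∧ 2 < N then (x.1 j - x.1 i) ^ 4 / 4 else 0) → ∀ J : (N : ℕ) → Literature.MathematicalPhysics.KineticTheory.HeatConduction.PhaseSpace N → ℝ, (∀ N : ℕ, J N = fun x : Literature.MathematicalPhysics.KineticTheory.HeatConduction.PhaseSpace N => (∑ i : Fin N, (Literature.MathematicalPhysics.KineticTheory.HeatConduction.OscillatorChain.mk (fun q => μ * q ^ 4 / 4) (fun r => r ^ 4 / 4) 0).bondCurrent N i x) + ∑ i : Fin N, ∑ j : Fin N, if i.val + 1 = N ∧ j.val = 0 ∧ 2 < N then -((x.2 i + x.2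 j) / 2 * (x.1 j - x.1 i) ^ 3) else 0) → ∀ Φ : (N : ℕ) → ℝ → Literature.MathematicalPhysics.KineticTheory.HeatConduction.PhaseSpace N → Literature.MathematicalPhysics.KineticTheory.HeatConduction.PhaseSpace N, (∀ N : ℕ, Literature.MathematicalPhysics.KineticTheory.NewtonianFlow.IsFlow (fun (q : Fin N → ℝ) (i : Fin N) => -Literature.MathematicalPhysics.KineticTheory.HeatConduction.partialQ i (H N) (q, fun _ => 0)) (Φ N)) → ∀ D : ℕ → ℝ, (∀ N : ℕ, Filter.Tendsto (fun t : ℝ => ∫ x, J N (Φ N t x) * J N x ∂((MeasureTheory.volume : MeasureTheory.Measure (Literature.MathematicalPhysics.KineticTheory.HeatConduction.PhaseSpace N)).tilted (fun x => -(H N) x / T))) Filter.atTop (nhds (D N))) → ∃ k : ℝ, 0 < k ∧ ∃ K : ℝ → ℝ, (∀ ε : ℝ, 0 < ε → Filter.Tendsto (fun N : ℕ => (N : ℝ)⁻¹ * ∫ t in Set.Ioi (0 : ℝ), Real.exp (-(ε * t)) * ((∫ x, J N (Φ N t x) * J N x ∂((MeasureTheory.volume : MeasureTheory.Measure (Literature.MathematicalPhysics.KineticTheory.HeatConduction.PhaseSpace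 N)).tilted (fun x => -(H N) x / T))) - D N)) Filter.atTop (nhds (K ε))) ∧ Filter.Tendsto K (nhdsWithin 0 (Set.Ioi 0)) (nhds k)

/-- item stmt-AtomisticToContinuum-4903 · crux · rank 4 · closed · moot by None · by planner
why it might fail: A positive-measure family of circulating (Π-asymmetric) KAM islands with non-vanishing Gibbs weight per site gives D_N ≍ N, a ballistic component; mixed phase space, no hyperbolicity, and the model is parameter-free, so there is no 'generic μ' escape.
sources: Mazur1969, Zotos2002, MackayPercival1985, HeidrichMeisnerHoneckerCabraBrenig2003, RigolShastry2008, BenentiCasatiMejiaMonasterioPeyrard2016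
[crux] (card (C1) ChiralIslandDecay) RING, every μ, T > 0: the finite-N Drude atom per site
vanishes, D_N/N → 0 (D_N = lim_t C_N(t), supplied by AnchorSpectralType). By momentum reversal Π (ΠJ
= −J, Πℐ = ℐ) the atom D_N = ‖E_T[J_N|ℐ]‖² is carried by Π-asymmetric (circulating, chiral)
invariant components only, so the statement says: chiral regular islands have vanishing Gibbs weight
per site — 'not ballistic at the anchor', the necessary half of 0 < κ₀ < ∞ on closed chains. [deps:
AnchorSpectralType] [difficulty: L] -/
@[route_item "route-AtomisticToContinuum-AffineAnchor"]
def RingDrudeDecay : Prop :=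
  ∀ (μ T : ℝ), 0 < μ → 0 < T → ∀ H : (N : ℕ) → Literature.MathematicalPhysics.KineticTheory.HeatConduction.PhaseSpace N → ℝ, (∀ N : ℕ, H N = fun x : Literature.MathematicalPhysics.KineticTheory.HeatConduction.PhaseSpace N => (Literature.MathematicalPhysics.KineticTheory.HeatConduction.OscillatorChain.mk (fun q => μ * q ^ 4 / 4) (fun r => r ^ 4 / 4) 0).hamiltonian N x + ∑ i : Fin N, ∑ j : Fin N, if i.val + 1 = N ∧ j.val = 0 ∧ 2 < N then (x.1 j - x.1 i) ^ 4 / 4 else 0) → ∀ J : (N : ℕ) → Literature.MathematicalPhysics.KineticTheory.HeatConduction.PhaseSpace N → ℝ, (∀ N : ℕ, J N = fun x : Literature.MathematicalPhysics.KineticTheory.HeatConduction.PhaseSpace N => (∑ i : Fin N, (Literature.MathematicalPhysics.KineticTheory.HeatConduction.OscillatorChain.mk (fun q => μ * q ^ 4 / 4) (fun r => r ^ 4 / 4) 0).bondCurrent N i x) + ∑ i : Fin N, ∑ j : Fin N, if i.val + 1 = N ∧ j.val = 0 ∧ 2 < N then -((x.2 i + x.2 j) / 2 * (x.1 j - x.1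 i) ^ 3) else 0) → ∀ Φ : (N : ℕ) → ℝ → Literature.MathematicalPhysics.KineticTheory.HeatConduction.PhaseSpace N → Literature.MathematicalPhysics.KineticTheory.HeatConduction.PhaseSpace N, (∀ N : ℕ, Literature.MathematicalPhysics.KineticTheory.NewtonianFlow.IsFlow (fun (q : Fin N → ℝ) (i : Fin N) => -Literature.MathematicalPhysics.KineticTheory.HeatConduction.partialQ i (H N) (q, fun _ => 0)) (Φ N)) → ∀ D : ℕ → ℝ, (∀ N : ℕ, Filter.Tendsto (fun t : ℝ => ∫ x, J N (Φ N t x) * J N x ∂((MeasureTheory.volume : MeasureTheory.Measure (Literature.MathematicalPhysics.KineticTheory.HeatConduction.PhaseSpace N)).tilted (fun x => -(H N) x / T))) Filter.atTop (nhds (D N))) → Filter.Tendsto (fun N : ℕ => D N / N) Filter.atTop (nhds 0)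

/-- item stmt-AtomisticToContinuum-4904 · crux · rank 5 · closed · moot by None · by planner
why it might fail: κ = κ_GK is unproved for every Hamiltonian bulk (BLR §7, Dhar §9e); at the anchor the bath coupling is the one non-scale-free datum (γ_eff = γT^{-1/4}), contact layers are T-dependent and must be o(N); needs N-uniform decay for the thermostatted chain.
sources: BonettoLebowitzReyBellet2000, Dhar2008, KunduDharNarayan2009, ReyBellet2003, HairerMajda2009, CuneoEckmannHairerReyBellet2018
[crux] (κ = κ_GK at the anchor, ring form) For the OPEN anchor chain quarticChain μ γ :=
OscillatorChain.mk (μq⁴/4) (r⁴/4) γ between Langevin baths and T > 0: if for the ring flow family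
the full Green–Kubo Abel means converge, N⁻¹∫_0^∞e^{−εt}C_N(t)dt → K(ε) (N → ∞) and K(ε) → k (ε ↓
0), then, under weak-NESS uniqueness, for every steady-state family and every sequence D_N of BLR
response coefficients (D_N(T) = lim_{δ→0} totalCurrent(ν_{N,T+δ/2,T−δ/2})/δ; existence = support
AnchorFiniteResponse, uniqueness of limits makes it canonical) one has D_N → k/T² (finite-volume
Kubo formula for the thermostatted chain + N-uniform decay + o(N) contact layers; the witness form
vetted on stmt-0742). [deps: AnchorRegularConductivity, RingDrudeDecay] [difficulty: open-problem] -/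
@[route_item "route-AtomisticToContinuum-AffineAnchor"]
def AnchorKuboFourier : Prop :=
  ∀ (μ γ T k : ℝ), 0 < μ → 0 < γ → 0 < T → ∀ H : (N : ℕ) → Literature.MathematicalPhysics.KineticTheory.HeatConduction.PhaseSpace N → ℝ, (∀ N : ℕ, H N = fun x : Literature.MathematicalPhysics.KineticTheory.HeatConduction.PhaseSpace N => (Literature.MathematicalPhysics.KineticTheory.HeatConduction.OscillatorChain.mk (fun q => μ * q ^ 4 / 4) (fun r => r ^ 4 / 4) 0).hamiltonian N x + ∑ i : Fin N, ∑ j : Fin N, if i.val + 1 = N ∧ j.val = 0 ∧ 2 < N then (x.1 j - x.1 i) ^ 4 / 4 else 0) → ∀ J : (N : ℕ) → Literature.MathematicalPhysics.KineticTheory.HeatConduction.PhaseSpace N → ℝ, (∀ N : ℕ, J N = fun x : Literature.MathematicalPhysics.KineticTheory.HeatConduction.PhaseSpace N => (∑ i : Fin N, (Literature.MathematicalPhysics.KineticTheory.HeatConduction.OscillatorChain.mk (fun q => μ * q ^ 4 / 4) (fun r => r ^ 4 / 4) 0).bondCurrent N i x) + ∑ i : Fin N, ∑ j : Fin N, if i.val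 + 1 = N ∧ j.val = 0 ∧ 2 < N then -((x.2 i + x.2 j) / 2 * (x.1 j - x.1 i) ^ 3) else 0) → ∀ Φ : (N : ℕ) → ℝ → Literature.MathematicalPhysics.KineticTheory.HeatConduction.PhaseSpace N → Literature.MathematicalPhysics.KineticTheory.HeatConduction.PhaseSpace N, (∀ N : ℕ, Literature.MathematicalPhysics.KineticTheory.NewtonianFlow.IsFlow (fun (q : Fin N → ℝ) (i : Fin N) => -Literature.MathematicalPhysics.KineticTheory.HeatConduction.partialQ i (H N) (q, fun _ => 0)) (Φ N)) → (∃ K : ℝ → ℝ, (∀ ε : ℝ, 0 < ε → Filter.Tendsto (fun N : ℕ => (N : ℝ)⁻¹ * ∫ t in Set.Ioi (0 : ℝ), Real.exp (-(ε * t)) * ∫ x, J N (Φ N t x) * J N x ∂((MeasureTheory.volume : MeasureTheory.Measure (Literature.MathematicalPhysics.KineticTheory.HeatConduction.PhaseSpace N)).tilted (fun x => -(H N) x / T))) Filter.atTop (nhds (K ε))) ∧ Filter.Tendsto K (nhdsWithin 0 (Set.Ioi 0)) (nhds k)) → (∀ (N : ℕ) (T_L T_R : ℝ), 0 < T_L →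 0 < T_R → ∀ ν ν' : MeasureTheory.Measure (Literature.MathematicalPhysics.KineticTheory.HeatConduction.PhaseSpace N), (Literature.MathematicalPhysics.KineticTheory.HeatConduction.OscillatorChain.mk (fun q => μ * q ^ 4 / 4) (fun r => r ^ 4 / 4) γ).IsSteadyState N T_L T_R ν → (Literature.MathematicalPhysics.KineticTheory.HeatConduction.OscillatorChain.mk (fun q => μ * q ^ 4 / 4) (fun r => r ^ 4 / 4) γ).IsSteadyState N T_L T_R ν' → ν = ν') → ∀ ν : (N : ℕ) → ℝ → ℝ → MeasureTheory.Measure (Literature.MathematicalPhysics.KineticTheory.HeatConduction.PhaseSpace N), (∀ (N : ℕ) (T_L T_R : ℝ), 0 < T_L → 0 < T_R → (Literature.MathematicalPhysics.KineticTheory.HeatConduction.OscillatorChain.mk (fun q => μ * q ^ 4 / 4) (fun r => r ^ 4 / 4) γ).IsSteadyState N T_L T_R (ν N T_L T_R)) → ∀ Dn : ℕ → ℝ, (∀ N : ℕ, Filter.Tendsto (fun δ : ℝ => (Literature.MathematicalPhysics.KineticTheory.HeatConduction.OscillatorChain.mk (fun q => μ * q ^ 4 / 4) (fun r => r ^ 4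 / 4) γ).totalCurrent (ν N (T + δ / 2) (T - δ / 2)) / δ) (nhdsWithin 0 {(0 : ℝ)}ᶜ) (nhds (Dn N))) → Filter.Tendsto Dn Filter.atTop (nhds (k / T ^ 2))

/-- item stmt-AtomisticToContinuum-4905 · crux · rank 6 · closed · moot by None · by planner
why it might fail: The antecedent controls only the T → ∞ end of the conjunct: η-continuation may meet non-perturbative low-amplitude weak links, and T < T₀ is the near-harmonic phonon regime (κ ~ (λT)⁻², LowTemperatureWeakAnharmonicity) where nothing is proved.
sources: AokiLukkarinenSpohn2006, CuneoEckmannHairerReyBellet2018, BonettoLebowitzReyBellet2000, LepriLiviPoliti2003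
[crux] IMPORT SLOT (thesis of card scale-free-quartic-anchor, not this route's mechanism): Fourier's
law for the whole anchor family implies the conjunct, (∀ μ γ > 0, FouriersLawFor (quarticChain μ γ))
→ FouriersLaw — via the proved scaling conjugacy (pinnedChain ω₂ lam β γ at T ≅ H_η at T = 1, η =
(βT)^{−1/2}, μ = lam/β), continuation in η for T ≥ T₀ and a kinetic-regime owner for T < T₀;
foreseen layer-2 children EtaContinuation / LowTGluing, to be shared with that card's route when it
opens. [deps: AnchorKuboFourier] [difficulty: open-problem] -/
@[route_item "route-AtomisticToContinuum-AffineAnchor"]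
def AnchorToConjunct : Prop :=
  (∀ μ γ : ℝ, 0 < μ → 0 < γ → (Literature.MathematicalPhysics.KineticTheory.HeatConduction.OscillatorChain.mk (fun q => μ * q ^ 4 / 4) (fun r => r ^ 4 / 4) γ).FouriersLawFor) → Literature.MathematicalPhysics.KineticTheory.HeatConduction.FouriersLaw

/-- item stmt-AtomisticToContinuum-4906 · support · rank 9 · closed · moot by None · by planner
sources: BonettoLebowitzReyBellet2000, CuneoEckmannHairerReyBellet2018
[support] For every N, μ > 0, θ ≥ 0, T > 0 the tilted measure volume.tilted(−H_θ/T) is a probability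
measure (e^{−H_θ/T} integrable: H_θ ≥ Σp²/2 + μΣq⁴/4) and the θ-ring current is in L²(Gibbs)
(polynomial × Gaussian-in-p × e^{−quartic}). De-vacuifies AnchorSpectralType for f = J_N; used by
the Assembly. [difficulty: provable-now] -/
@[route_item "route-AtomisticToContinuum-AffineAnchor"]
def AnchorCurrentMemLp : Prop :=
  ∀ (N : ℕ) (μ θ T : ℝ), 0 < μ → 0 ≤ θ → 0 < T → ∀ H : Literature.MathematicalPhysics.KineticTheory.HeatConduction.PhaseSpace N → ℝ, H = (fun x : Literature.MathematicalPhysics.KineticTheory.HeatConduction.PhaseSpace N => (Literature.MathematicalPhysics.KineticTheory.HeatConduction.OscillatorChain.mk (fun q => μ * q ^ 4 / 4) (fun r => r ^ 4 / 4) 0).hamiltonian N x + θ * ∑ i : Fin N, ∑ j : Fin N, if i.val + 1 = N ∧ j.val = 0 ∧ 2 < N then (x.1 j - x.1 i) ^ 4 / 4 else 0) → ∀ J : Literature.MathematicalPhysics.KineticTheory.HeatConduction.PhaseSpace N → ℝ, J = (fun x : Literature.MathematicalPhysics.KineticTheory.HeatConduction.PhaseSpace N => (∑ i : Fin N, (Literature.MathematicalPhysics.KineticTheory.HeatConduction.OscillatorChain.mk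 (fun q => μ * q ^ 4 / 4) (fun r => r ^ 4 / 4) 0).bondCurrent N i x) + ∑ i : Fin N, ∑ j : Fin N, if i.val + 1 = N ∧ j.val = 0 ∧ 2 < N then -((x.2 i + x.2 j) / 2 * (θ * (x.1 j - x.1 i) ^ 3)) else 0) → MeasureTheory.IsProbabilityMeasure ((MeasureTheory.volume : MeasureTheory.Measure (Literature.MathematicalPhysics.KineticTheory.HeatConduction.PhaseSpace N)).tilted (fun x => -H x / T)) ∧ MeasureTheory.MemLp J 2 ((MeasureTheory.volume : MeasureTheory.Measure (Literature.MathematicalPhysics.KineticTheory.HeatConduction.PhaseSpace N)).tilted (fun x => -H x / T))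

/-- item stmt-AtomisticToContinuum-4907 · support · rank 9 · closed · moot by None · by planner
sources: BonettoLebowitzReyBellet2000, LanfordLebowitzLieb1977
[support] For every N, μ > 0, θ ≥ 0 the Newtonian flow of H_θ exists globally (energy conservation +
coercivity; local Lipschitz uniqueness), conserves H_θ, and preserves Lebesgue measure (Liouville —
truncate the cubic field on a sublevel set of H_θ and use the tree's bounded-Lipschitz Liouville,
NewtonianFlowLiouville). De-vacuifies the ∀Φ-items; the Assembly needs a flow family. [difficulty:
provable-now] -/
@[route_item "route-AtomisticToContinuum-AffineAnchor"]
def AnchorFlow : Prop :=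
  ∀ (N : ℕ) (μ θ : ℝ), 0 < μ → 0 ≤ θ → ∀ H : Literature.MathematicalPhysics.KineticTheory.HeatConduction.PhaseSpace N → ℝ, H = (fun x : Literature.MathematicalPhysics.KineticTheory.HeatConduction.PhaseSpace N => (Literature.MathematicalPhysics.KineticTheory.HeatConduction.OscillatorChain.mk (fun q => μ * q ^ 4 / 4) (fun r => r ^ 4 / 4) 0).hamiltonian N x + θ * ∑ i : Fin N, ∑ j : Fin N, if i.val + 1 = N ∧ j.val = 0 ∧ 2 < N then (x.1 j - x.1 i) ^ 4 / 4 else 0) → ∃ Φ : ℝ → Literature.MathematicalPhysics.KineticTheory.HeatConduction.PhaseSpace N → Literature.MathematicalPhysics.KineticTheory.HeatConduction.PhaseSpace N, Literature.MathematicalPhysics.KineticTheory.NewtonianFlow.IsFlow (fun (q : Fin N → ℝ) (i : Fin N) => -Literature.MathematicalPhysics.KineticTheory.HeatConduction.partialQ i H (q, fun _ => 0)) Φ ∧ (∀ (t : ℝ) (x : Literature.MathematicalPhysics.KineticTheory.HeatConduction.PhaseSpace N), H (Φ t x) = H x) ∧ ∀ t : ℝ, MeasureTheory.MeasurePreserving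 (Φ t) MeasureTheory.volume MeasureTheory.volume

/-- item stmt-AtomisticToContinuum-4908 · support · rank 9 · closed · moot by None · by planner
sources: BenentiCasatiMejiaMonasterioPeyrard2016
[support] Pure real analysis: for continuous c_N with |c_N(t)| ≤ c_N(0), c_N(t) → D_N, D_N/N → 0 and
N⁻¹∫_0^∞e^{−εt}(c_N − D_N) → K(ε) for every ε > 0, also N⁻¹∫_0^∞e^{−εt}c_N → K(ε) (the atom
contributes D_N/(Nε) → 0). [difficulty: provable-now] -/
@[route_item "route-AtomisticToContinuum-AffineAnchor"]
def DrudeRegularGlue : Prop :=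
  ∀ (C : ℕ → ℝ → ℝ) (D : ℕ → ℝ) (K : ℝ → ℝ), (∀ N : ℕ, Continuous (C N)) → (∀ (N : ℕ) (t : ℝ), |C N t| ≤ C N 0) → (∀ N : ℕ, Filter.Tendsto (C N) Filter.atTop (nhds (D N))) → Filter.Tendsto (fun N : ℕ => D N / N) Filter.atTop (nhds 0) → (∀ ε : ℝ, 0 < ε → Filter.Tendsto (fun N : ℕ => (N : ℝ)⁻¹ * ∫ t in Set.Ioi (0 : ℝ), Real.exp (-(ε * t)) * (C N t - D N)) Filter.atTop (nhds (K ε))) → ∀ ε : ℝ, 0 < ε → Filter.Tendsto (fun N : ℕ => (N : ℝ)⁻¹ * ∫ t in Set.Ioi (0 : ℝ), Real.exp (-(ε * t)) * C N t) Filter.atTop (nhds (K ε))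

/-- item stmt-AtomisticToContinuum-4909 · support · rank 9 · closed · moot by None · by planner
sources: ReyBellet2003, HairerMajda2009, CuneoEckmannHairerReyBellet2018, Carmona2007
[support] Finite-N linear response exists for the open anchor chain: for quarticChain μ γ (μ, γ >
0), under weak-NESS uniqueness, for every steady-state family, T > 0 and N the limit D_N = lim_{δ→0,
δ≠0} totalCurrent(ν_{N,T+δ/2,T−δ/2})/δ exists (differentiability at equilibrium of NESS expectations
of the polynomial currents in the bath temperatures; ReyBellet2003 Rem 4.4 finite-volume Green–Kubo,
HairerMajda2009 framework; the quarticChain analogue of stmt-0717). [difficulty: L] -/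
@[route_item "route-AtomisticToContinuum-AffineAnchor"]
def AnchorFiniteResponse : Prop :=
  ∀ μ γ : ℝ, 0 < μ → 0 < γ → (∀ (N : ℕ) (T_L T_R : ℝ), 0 < T_L → 0 < T_R → ∀ ν ν' : MeasureTheory.Measure (Literature.MathematicalPhysics.KineticTheory.HeatConduction.PhaseSpace N), (Literature.MathematicalPhysics.KineticTheory.HeatConduction.OscillatorChain.mk (fun q => μ * q ^ 4 / 4) (fun r => r ^ 4 / 4) γ).IsSteadyState N T_L T_R ν → (Literature.MathematicalPhysics.KineticTheory.HeatConduction.OscillatorChain.mk (fun q => μ * q ^ 4 / 4) (fun r => r ^ 4 / 4) γ).IsSteadyState N T_L T_R ν' → ν = ν') → ∀ ν : (N : ℕ) → ℝ → ℝ → MeasureTheory.Measure (Literature.MathematicalPhysics.KineticTheory.HeatConduction.PhaseSpace N), (∀ (N : ℕ) (T_L T_R : ℝ), 0 < T_L → 0 < T_R → (Literature.MathematicalPhysics.KineticTheory.HeatConduction.OscillatorChain.mk (fun q => μ * q ^ 4 / 4) (fun r => r ^ 4 / 4) γ).IsSteadyState N T_L T_R (ν N T_L T_R)) → ∀ T :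 ℝ, 0 < T → ∀ N : ℕ, ∃ D : ℝ, Filter.Tendsto (fun δ : ℝ => (Literature.MathematicalPhysics.KineticTheory.HeatConduction.OscillatorChain.mk (fun q => μ * q ^ 4 / 4) (fun r => r ^ 4 / 4) γ).totalCurrent (ν N (T + δ / 2) (T - δ / 2)) / δ) (nhdsWithin 0 {(0 : ℝ)}ᶜ) (nhds D)

/-- item stmt-AtomisticToContinuum-4910 · support · rank 9 · closed · moot by None · by planner
sources: CuneoEckmannHairerReyBellet2018, Carmona2007, EckmannPilletReyBellet1999b, ReyBelletThomas2002
[support] Clause (i) for the anchor: for quarticChain μ γ (μ, γ > 0), every N and T_L, T_R > 0, a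
weak steady state (IsSteadyState) exists and is unique. CEHR2018 Thm 2.13 pattern (coupling degree 4
= pinning degree 4, C5 with equality; homogeneity at infinity ideal for the Lyapunov function) but
C1 (non-degenerate interaction) fails at zero stretch, V″(0) = 0 — Hörmander via V⁗ = 6 ≠ 0; plus
the weak-Fokker–Planck identification shared with stmt-0741. [difficulty: L] -/
@[route_item "route-AtomisticToContinuum-AffineAnchor"]
def AnchorNess : Prop :=
  ∀ μ γ : ℝ, 0 < μ → 0 < γ → ∀ (N : ℕ) (T_L T_R : ℝ), 0 < T_L → 0 < T_R → ∃ ν : MeasureTheory.Measure (Literature.MathematicalPhysics.KineticTheory.HeatConduction.PhaseSpace N), (Literature.MathematicalPhysics.KineticTheory.HeatConduction.OscillatorChain.mk (fun q => μ * q ^ 4 / 4) (fun r => r ^ 4 / 4) γ).IsSteadyState N T_L T_R ν ∧ ∀ ν' : MeasureTheory.Measure (Literature.MathematicalPhysics.KineticTheory.HeatConduction.PhaseSpace N), (Literature.MathematicalPhysics.KineticTheory.HeatConduction.OscillatorChain.mk (fun q => μ * q ^ 4 / 4) (fun r => r ^ 4 / 4) γ).IsSteadyState N T_L T_R ν' →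 ν' = ν

/-- item stmt-AtomisticToContinuum-4911 · support · rank 9 · closed · moot by None · by planner
sources: RigolShastry2008, Mazur1969
[support] (card corollary (3), calibration; not in the Assembly) FREE ENDS (θ = 0), every N, μ, T >
0: J_N = 𝓛G_N with the energy dipole G_N = Σ_x x·h_x, so J_N ⊥ ker 𝓛: C_N(t) → 0 as t → ∞ AND the
Abel-regularised finite-N Green–Kubo integral ∫_0^∞e^{−εt}C_N(t)dt → 0 as ε ↓ 0 — finite free-end
anchor chains are exact insulators at ω = 0 (σ_J = ω²σ_G), so κ₀ > 0 is a singular N → ∞ limit there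
and closed-chain certificates must live on rings or on the pre-recurrence window. [difficulty: M] -/
@[route_item "route-AtomisticToContinuum-AffineAnchor"]
def FreeEndInsulator : Prop :=
  ∀ (N : ℕ) (μ T : ℝ), 0 < μ → 0 < T → ∀ H : Literature.MathematicalPhysics.KineticTheory.HeatConduction.PhaseSpace N → ℝ, H = (fun x : Literature.MathematicalPhysics.KineticTheory.HeatConduction.PhaseSpace N => (Literature.MathematicalPhysics.KineticTheory.HeatConduction.OscillatorChain.mk (fun q => μ * q ^ 4 / 4) (fun r => r ^ 4 / 4) 0).hamiltonian N x) → ∀ J : Literature.MathematicalPhysics.KineticTheory.HeatConduction.PhaseSpace N → ℝ, J = (fun x : Literature.MathematicalPhysics.KineticTheory.HeatConduction.PhaseSpace N => ∑ i : Fin N, (Literature.MathematicalPhysics.KineticTheory.HeatConduction.OscillatorChain.mk (fun q => μ * q ^ 4 / 4) (fun r => r ^ 4 / 4) 0).bondCurrent N i x) → ∀ Φ : ℝ → Literature.MathematicalPhysics.KineticTheory.HeatConduction.PhaseSpace N → Literature.MathematicalPhysics.KineticTheory.HeatConduction.PhaseSpace N, Literature.MathematicalPhysics.KineticTheory.NewtonianFlow.IsFlow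 (fun (q : Fin N → ℝ) (i : Fin N) => -Literature.MathematicalPhysics.KineticTheory.HeatConduction.partialQ i H (q, fun _ => 0)) Φ → Filter.Tendsto (fun t : ℝ => ∫ x, J (Φ t x) * J x ∂((MeasureTheory.volume : MeasureTheory.Measure (Literature.MathematicalPhysics.KineticTheory.HeatConduction.PhaseSpace N)).tilted (fun x => -H x / T))) Filter.atTop (nhds 0) ∧ Filter.Tendsto (fun ε : ℝ => ∫ t in Set.Ioi (0 : ℝ), Real.exp (-(ε * t)) * ∫ x, J (Φ t x) * J x ∂((MeasureTheory.volume : MeasureTheory.Measure (Literature.MathematicalPhysics.KineticTheory.HeatConduction.PhaseSpace N)).tilted (fun x => -H x / T))) (nhdsWithin 0 (Set.Ioi 0)) (nhds 0)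

/-- item stmt-AtomisticToContinuum-4912 · assembly · rank 1 · closed · moot by None · by planner
sources: BonettoLebowitzReyBellet2000, BernardinOlla2005
[assembly] AnchorSpectralType → AnchorCurrentMemLp → AnchorFlow → RingDrudeDecay →
AnchorRegularConductivity → DrudeRegularGlue → AnchorFiniteResponse → AnchorKuboFourier → AnchorNess
→ AnchorToConjunct → FouriersLaw. -/
@[route_item "route-AtomisticToContinuum-AffineAnchor"]
def Assembly : Prop :=
  AnchorSpectralType → AnchorCurrentMemLp → AnchorFlow → RingDrudeDecay → AnchorRegularConductivity → DrudeRegularGlue → AnchorFiniteResponse → AnchorKuboFourier → AnchorNess → AnchorToConjunct → Literature.MathematicalPhysics.KineticTheory.HeatConduction.FouriersLaw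

end Summit.AtomisticToContinuum.FouriersLaw.Theses.AffineAnchor
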